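import Summits.AtomisticToContinuum.BoseEinsteinCondensation.Theorems.BECGroundStateSOSPeriodicIRBoundTwoSectorPairDefs2
import Summits.AtomisticToContinuum.BoseEinsteinCondensation.Theorems.BECGroundStateSOSPeriodicIRBoundTwoSectorLinearFloorArrow
import HarnessLib

/-!
# Route `BECGroundStateSOS`, crux `PeriodicIRBound` (stmt-AtomisticToContinuum-3972), line `two-sector-gd-transfer`
# (v11 "pointwise floating + soft location") — stub S11d₂ᵦ `stub_softLocationOfGap : SoftLocationOfGap`

Supports (does not close) stmt-AtomisticToContinuum-3972. The registered stub S11d₂ᵦ of the v11 skeleton (statement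
`SoftLocationOfGap` in `Theorems/BECGroundStateSOSPeriodicIRBoundTwoSectorPairDefs2.lean`): the soft-location arrow
`SoftLocation` (for an integrable admissible `v` with `∫v ≠ 0`, the infrared inequality `IRBoundFor v` gives, for every
`K > 0`, data `ρ₀, C > 0`, `A ≥ 0` with the per-state floating two-channel bound `FloatingPairLow v K ρ₀ C A`) assembled
from its three inputs, taken as hypotheses — the effective gap at fixed `(N, L)` (S11d₂ₐ `EffectiveGapAt`), the condensate
fraction `7/8` from the infrared bound (S11c `CondensateFractionOfIR`) and the real-algebra core (S11d₁ `PairSharesReal`).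
Filters and window arithmetic only (`Cruxes/PeriodicIRBound/SOFT-LOCATION.md`, Steps 4–5).

Proof. Fix `K > 0`, `κ := K/(2π)`. (1) `IRBoundFor v` at `κ`: data `ρX, C_X` and, for `ρ < ρX`, eventually in `N` a slack
`δ_X` with `n_k(Ψ) ≤ Bm := C_X√ρL/‖n‖_∞` on the crux window `InWindow κ`, which is the low window `2π‖n‖_∞/L ≤ K√ρ`.
(2) S11c: `ρB` and, for `ρ < ρB`, eventually in `N` a slack `δ_B` with `n₀(Ψ) ≥ (7/8)N`. (3) A range `R > 0` of `v` and
`ρR := (1/(4√3KR))²`: on the window `‖p‖ ≤ √3K√ρ` (`p = 2πn/L`), so `‖p‖R ≤ 1/4` for `ρ < ρR`. (4) Constants: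
`‖v‖₁ > 0`, `C := 1/π² + 16C_X²/‖v‖₁`, `A := κ(C_X+κ)/C`, `ρ₀ := min ρX (min ρB ρR)`, `b := CL²/‖n‖²_∞`. (5) Per state: the
effective gap at `θ = 7/8`, `η' := ρ‖v‖₁/32` gives, since `N/L³ = ρ`, `G := ‖p‖² + ρ‖v‖₁/2 ≤ qA + qC − e0(2n_k+1) − (e0 − e0m)`
with the three variational bounds; the numeric gap `(Bm+1)(2Bm+1) ≤ 4Bm² + 4 ≤ bG` (`b‖p‖² ≥ 4π²C ≥ 4` from
`‖p‖ ≥ 2π‖n‖_∞/L`, `bρ‖v‖₁/2 ≥ 8Bm²`) and the guard `(Bm+1)/b ≤ Aρ` (`FloorArrow.B_add_one_div_le`) feed S11d₁ with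
`Fl := G + (e0 − e0m)`, which returns one chemical potential `μ ≥ −(Bm+1)/b ≥ −Aρ` carrying both shares; `μ₊ = μ₋ = μ`.
The least slack `min δ_X (min δ_B δ_G)` works. Nothing is cited as a fact; references for the shape only: T. Kennedy,
E. H. Lieb, B. S. Shastry, J. Stat. Phys. 53 (1988) 1019, (12)–(14).
-/

noncomputable section

open scoped BigOperators ENNReal
open Filter MeasureTheory

namespace Summit.AtomisticToContinuum.BoseEinsteinCondensation.Cruxes.PeriodicIRBound.TwoSectorGdTransfer

open Literature.MathematicalPhysics.QuantumManyBody.BoseGas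
open Summit.AtomisticToContinuum.BoseEinsteinCondensation.Theorems.PeriodicIRBound.Negative
  (IRBoundFor NearMin InWindow IRIneq irIneq_iff norm_intVec_le_sqrt_nsq sqrt_nsq_le_sqrt_three_mul_norm)
open Summit.AtomisticToContinuum.BoseEinsteinCondensation.Theorems.GaussianDominationCan.Negative
  (nsq nsq_nonneg one_le_norm_intVec)
open Summit.AtomisticToContinuum.BoseEinsteinCondensation.Cruxes.PeriodicIRBound.LinearPhFloorWagner
  (TransferArith.norm_latticeVec_eq WF.wL1 WF.qform)

/-! ### Real arithmetic: the numeric gap and the per-state shares -/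

namespace SoftLoc

/-- **Numeric gap**: with `Bm = C_X s L/ν`, `b = (1/π² + 16C_X²/w)L²/ν²` and `P ≥ 2πν/L`:
`(Bm+1)(2Bm+1) ≤ 4Bm² + 4 ≤ b(P² + s²w/2)`. [folklore] -/
theorem numeric_gap {CX w L ν s P : ℝ} (hw : 0 < w) (hL : 0 < L) (hν : 0 < ν) (hP : 2 * Real.pi / L * ν ≤ P) :
    (CX * s * L / ν + 1) * (2 * (CX * s * L / ν) + 1) ≤
      (1 / Real.pi ^ 2 + 16 * CX ^ 2 / w) * L ^ 2 / ν ^ 2 * (P ^ 2 + s ^ 2 * w / 2) := by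
  set Bm : ℝ := CX * s * L / ν with hBm
  have hb : 0 ≤ (1 / Real.pi ^ 2 + 16 * CX ^ 2 / w) * L ^ 2 / ν ^ 2 := by positivity
  have h1 : (Bm + 1) * (2 * Bm + 1) ≤ 4 * Bm ^ 2 + 4 := by nlinarith [sq_nonneg (Bm - 1)]
  have h2 : 4 ≤ (1 / Real.pi ^ 2 + 16 * CX ^ 2 / w) * L ^ 2 / ν ^ 2 * P ^ 2 := by
    have hP0 : 0 ≤ 2 * Real.pi / L * ν := by positivity
    have hP2 : (2 * Real.pi / L * ν) ^ 2 ≤ P ^ 2 := pow_le_pow_left₀ hP0 hP 2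
    have hCge : 1 / Real.pi ^ 2 ≤ 1 / Real.pi ^ 2 + 16 * CX ^ 2 / w := le_add_of_nonneg_right (by positivity)
    calc (4 : ℝ) = 1 / Real.pi ^ 2 * L ^ 2 / ν ^ 2 * (2 * Real.pi / L * ν) ^ 2 := by
          field_simp
          norm_num
      _ ≤ (1 / Real.pi ^ 2 + 16 * CX ^ 2 / w) * L ^ 2 / ν ^ 2 * (2 * Real.pi / L * ν) ^ 2 := by gcongr
      _ ≤ (1 / Real.pi ^ 2 + 16 * CX ^ 2 / w) * L ^ 2 / ν ^ 2 * P ^ 2 := mul_le_mul_of_nonneg_left hP2 hb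
  have h3 : 4 * Bm ^ 2 ≤ (1 / Real.pi ^ 2 + 16 * CX ^ 2 / w) * L ^ 2 / ν ^ 2 * (s ^ 2 * w / 2) := by
    have hCge : 16 * CX ^ 2 / w ≤ 1 / Real.pi ^ 2 + 16 * CX ^ 2 / w := le_add_of_nonneg_left (by positivity)
    calc 4 * Bm ^ 2 ≤ 8 * Bm ^ 2 := by nlinarith [sq_nonneg Bm]
      _ = 16 * CX ^ 2 / w * L ^ 2 / ν ^ 2 * (s ^ 2 * w / 2) := by
          rw [hBm]
          field_simp
          ring
      _ ≤ (1 / Real.pi ^ 2 + 16 * CX ^ 2 / w) * L ^ 2 / ν ^ 2 * (s ^ 2 * w / 2) := by gcongr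
  calc (Bm + 1) * (2 * Bm + 1) ≤ 4 * Bm ^ 2 + 4 := h1
    _ ≤ (1 / Real.pi ^ 2 + 16 * CX ^ 2 / w) * L ^ 2 / ν ^ 2 * (s ^ 2 * w / 2) +
          (1 / Real.pi ^ 2 + 16 * CX ^ 2 / w) * L ^ 2 / ν ^ 2 * P ^ 2 := add_le_add h3 h2
    _ = (1 / Real.pi ^ 2 + 16 * CX ^ 2 / w) * L ^ 2 / ν ^ 2 * (P ^ 2 + s ^ 2 * w / 2) := by ring

/-- **Per-state shares from the effective gap** (S11d₁ applied): the effective gap at `θ = 7/8`, `η' = ρw/32` reads,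
once `N‖v‖₁/L³ = ρ‖v‖₁`, `G := P² + ρw/2 ≤ qA + qC − e0(2nk+1) − (e0 − e0m)`; with the numeric gap
`(Bm+1)(2Bm+1) ≤ bG` and the guard `(Bm+1)/b ≤ Aρ`, `PairSharesReal` at `Fl := G + (e0 − e0m)` gives one chemical
potential `μ ≥ −Aρ` carrying both shares (`μ₊ = μ₋ = μ`, coupling slack `e ≥ 0` unused). [folklore] -/
theorem shares (hReal : PairSharesReal) {nk qA qC e0 e0m e0p b Bm P2 X ρw η Aρ e : ℝ} (hb : 0 < b)
    (hnk0 : 0 ≤ nk) (hnk : nk ≤ Bm) (hη : 0 < η) (hA : e0m * nk ≤ qA) (hC : e0p * (nk + 1) ≤ qC) (hep : e0 ≤ e0p)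
    (hFl : P2 + (7 * (7 / 8) / 4 - 1) * X - ρw / 32 ≤ qA + qC - e0 * (2 * nk + 1) - (e0 - e0m)) (hX : X = ρw)
    (hgap : (Bm + 1) * (2 * Bm + 1) ≤ b * (P2 + ρw / 2)) (hguard : (Bm + 1) / b ≤ Aρ) (he : 0 ≤ e) :
    ∃ μp μm : ℝ, -Aρ ≤ μp ∧ μm ≤ μp + e ∧
      (nk + 1) ^ 2 ≤ b * ((1 + η) * (qC - (e0 + μp) * (nk + 1)) + η * (nk + 1)) ∧
      nk ^ 2 ≤ b * ((1 + η) * (qA - (e0 - μm) * nk) + η * nk) := by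
  rw [hX] at hFl
  obtain ⟨μ, hμ, hP, hM⟩ := hReal nk qA qC e0 e0m e0p b Bm (P2 + ρw / 2 + (e0 - e0m)) η hb hnk0 hnk hη hA hC
    hep (by linarith) (by rwa [add_sub_cancel_right])
  exact ⟨μ, μ, by linarith, le_add_of_nonneg_right he, hP, hM⟩

end SoftLoc

/-! ### The stub -/

/-- **Stub S11d₂ᵦ — the soft-location arrow from the effective gap.** Given the effective gap at fixed `(N, L)`
(S11d₂ₐ), the condensate fraction `7/8` from the infrared bound (S11c) and the real-algebra core (S11d₁), every integrable
admissible `v` with `∫v ≠ 0` and `IRBoundFor v` carries, for every `K > 0`, data `ρ₀, C > 0`, `A ≥ 0` with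
`FloatingPairLow v K ρ₀ C A` (`C = 1/π² + 16C_X²/‖v‖₁`, `A = κ(C_X+κ)/C`, `κ = K/(2π)`; see the module docstring).
[folklore] -/
theorem stub_softLocationOfGap : SoftLocationOfGap := by
  intro hGap hBEC hReal v hv hint h0 hIR K hK
  -- constants, part 1: `κ = K/(2π)`
  have hκ : 0 < K / (2 * Real.pi) := by positivity
  set κ : ℝ := K / (2 * Real.pi) with hκdef
  -- (1) the infrared bound at window parameter `κ`
  obtain ⟨ρX, hρX, CX, hCX, hIRW⟩ := hIR κ hκ
  -- (2) the condensate fraction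
  obtain ⟨ρB, hρB, hBECW⟩ := hBEC v hv hIR
  -- (3) a positive range of `v`
  obtain ⟨R, hR, hvR⟩ := hv.exists_pos_range
  have h3 : 0 < Real.sqrt 3 := Real.sqrt_pos.2 (by norm_num)
  have hρR : 0 < (1 / (4 * Real.sqrt 3 * K * R)) ^ 2 := by positivity
  -- (4) `‖v‖₁ > 0` and the constants
  have hw : 0 < WF.wL1 v := ENNReal.toReal_pos h0 hint
  have hC : 0 < 1 / Real.pi ^ 2 + 16 * CX ^ 2 / WF.wL1 v := by positivity
  set C : ℝ := 1 / Real.pi ^ 2 + 16 * CX ^ 2 / WF.wL1 v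
  have hA : 0 ≤ κ * (CX + κ) / C := by positivity
  set A : ℝ := κ * (CX + κ) / C
  refine ⟨min ρX (min ρB ((1 / (4 * Real.sqrt 3 * K * R)) ^ 2)), lt_min hρX (lt_min hρB hρR), C, hC, A, hA,
    fun ε hε ρ hρ hρlt => ?_⟩
  have hρ1 : ρ < ρX := hρlt.trans_le (min_le_left _ _)
  have hρ2 : ρ < ρB := hρlt.trans_le ((min_le_right _ _).trans (min_le_left _ _))
  have hρ3 : ρ < (1 / (4 * Real.sqrt 3 * K * R)) ^ 2 := hρlt.trans_le ((min_le_right _ _).trans (min_le_right _ _))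
  have hsρ : Real.sqrt ρ ≤ 1 / (4 * Real.sqrt 3 * K * R) := by
    have h := Real.sqrt_le_sqrt hρ3.le
    rwa [Real.sqrt_sq (by positivity)] at h
  -- (5) both eventualities, read along `N = m + 2`
  have hev := (tendsto_add_atTop_nat 2).eventually ((hIRW ρ hρ hρ1).and (hBECW ρ hρ hρ2))
  filter_upwards [hev] with m hm
  obtain ⟨⟨δX, hδX, hIRm⟩, δB, hδB, hBECm⟩ := hm
  intro n hn hwin
  -- (6) the mode: `L`, `L³ = N/ρ`, `ν = ‖n‖_∞`, the window, the dual momentum `p = 2πn/L`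
  have hL : 0 < sideLength ρ (m + 2) := sideLength_pos_of_pos hρ (by omega)
  have hL3 : sideLength ρ (m + 2) ^ 3 = ((m : ℝ) + 2) / ρ := by
    have h := sideLength_pow_three hρ (m + 2)
    push_cast at h
    exact h
  have hρw : ((m : ℝ) + 2) * WF.wL1 v / sideLength ρ (m + 2) ^ 3 = ρ * WF.wL1 v := by
    have hm : (0 : ℝ) < (m : ℝ) + 2 := by positivity
    rw [hL3]
    field_simp
  set L := sideLength ρ (m + 2)
  have hn1 : 1 ≤ ‖(fun j => (n j : ℝ))‖ := one_le_norm_intVec hn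
  set ν : ℝ := ‖(fun j => (n j : ℝ))‖
  have hν : 0 < ν := one_pos.trans_le hn1
  have hc : 0 < 2 * Real.pi / L := by positivity
  have hwin' : 2 * Real.pi * ν ≤ K * Real.sqrt ρ * L :=
    calc 2 * Real.pi * ν = 2 * Real.pi / L * ν * L := by field_simp
      _ ≤ K * Real.sqrt ρ * L := mul_le_mul_of_nonneg_right hwin hL.le
  have hνL : ν ≤ κ * Real.sqrt ρ * L := by
    rw [hκdef, div_mul_eq_mul_div, div_mul_eq_mul_div, le_div_iff₀ (by positivity : (0 : ℝ) < 2 * Real.pi)]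
    linarith
  have hnw : InWindow κ ρ (m + 2) n := ⟨hn, hνL⟩
  set p : Space := latticeVec (2 * Real.pi / L) n with hpdef
  have hP : ‖p‖ = 2 * Real.pi / L * Real.sqrt (nsq n) := by
    rw [hpdef, TransferArith.norm_latticeVec_eq, abs_of_pos hc]
  have hPge : 2 * Real.pi / L * ν ≤ ‖p‖ := by
    rw [hP]
    exact mul_le_mul_of_nonneg_left (norm_intVec_le_sqrt_nsq n) hc.le
  have hPle : ‖p‖ ≤ Real.sqrt 3 * (K * Real.sqrt ρ) :=
    calc ‖p‖ ≤ 2 * Real.pi / L * (Real.sqrt 3 * ν) := by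
          rw [hP]
          exact mul_le_mul_of_nonneg_left (sqrt_nsq_le_sqrt_three_mul_norm n) hc.le
      _ = Real.sqrt 3 * (2 * Real.pi / L * ν) := by ring
      _ ≤ Real.sqrt 3 * (K * Real.sqrt ρ) := mul_le_mul_of_nonneg_left hwin (Real.sqrt_nonneg _)
  -- the range condition `‖p‖ R ≤ 1/4`
  have hpR : ‖p‖ * R ≤ 1 / 4 :=
    calc ‖p‖ * R ≤ Real.sqrt 3 * (K * Real.sqrt ρ) * R := mul_le_mul_of_nonneg_right hPle hR.le
      _ ≤ Real.sqrt 3 * (K * (1 / (4 * Real.sqrt 3 * K * R))) * R := by gcongr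
      _ = 1 / 4 := by
          field_simp
  -- (7) the a-priori bound `Bm`, the channel bound `b`, the guard and the numeric gap
  have hB : 0 ≤ CX * Real.sqrt ρ * L / ν := by positivity
  have hb : 0 < C * L ^ 2 / ν ^ 2 := by positivity
  have hKb : (CX * Real.sqrt ρ * L / ν + 1) / (C * L ^ 2 / ν ^ 2) ≤ A * ρ := by
    have h := FloorArrow.B_add_one_div_le hCX.le hC hL (Real.sqrt_nonneg ρ) hn1 hνL
    rwa [Real.sq_sqrt hρ.le] at h
  have hgapN : (CX * Real.sqrt ρ * L / ν + 1) * (2 * (CX * Real.sqrt ρ * L / ν) + 1) ≤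
      C * L ^ 2 / ν ^ 2 * (‖p‖ ^ 2 + ρ * WF.wL1 v / 2) := by
    have h := SoftLoc.numeric_gap (CX := CX) (s := Real.sqrt ρ) hw hL hν hPge
    rwa [Real.sq_sqrt hρ.le] at h
  set Bm : ℝ := CX * Real.sqrt ρ * L / ν
  set b : ℝ := C * L ^ 2 / ν ^ 2
  -- (8) per state: the effective gap at `θ = 7/8`, `η' = ρ‖v‖₁/32`, and the least slack
  intro η hη
  obtain ⟨δG, hδG, hG⟩ :=
    hGap v hv hint R hR hvR m L hL n hn hpR (7 / 8) (ρ * WF.wL1 v / 32) (by norm_num) (by positivity)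
  refine ⟨min δX (min δB δG), lt_min hδX (lt_min hδB hδG), fun Ψ hΨ h0Ψ => ?_⟩
  have hΨX : NearMinAt v δX Ψ := hΨ.trans (add_le_add le_rfl (min_le_left _ _))
  have hΨB : NearMinAt v δB Ψ := hΨ.trans (add_le_add le_rfl ((min_le_right _ _).trans (min_le_left _ _)))
  have hΨG : NearMinAt v δG Ψ := hΨ.trans (add_le_add le_rfl ((min_le_right _ _).trans (min_le_right _ _)))
  -- (9) the occupation bound from the infrared bound and the condensate fraction
  have hnk : (cellOccupation (m + 2) L (planeWaveMode L n) Ψ.ψ).toReal ≤ Bm := by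
    have h := hIRm Ψ ((nearMin_iff v ρ (m + 2) δX Ψ).2 hΨX) n hnw
    rw [irIneq_iff] at h
    exact ENNReal.toReal_le_of_le_ofReal hB h
  have hn0 : 7 / 8 * ((m : ℝ) + 2) ≤ (cellOccupation (m + 2) L (planeWaveMode L 0) Ψ.ψ).toReal := by
    have hfin : cellOccupation (m + 2) L (planeWaveMode L 0) Ψ.ψ ≠ ⊤ :=
      ne_top_of_le_ne_top (ENNReal.natCast_ne_top (m + 2)) (Ψ.cellOccupation_planeWaveMode_le hL 0)
    have h := (ENNReal.ofReal_le_iff_le_toReal hfin).1 (hBECm Ψ ((nearMin_iff v ρ (m + 2) δB Ψ).2 hΨB))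
    push_cast at h
    exact h
  -- (10) the effective gap and the shares
  obtain ⟨hFl, hA', hC', hep⟩ := hG Ψ hΨG h0Ψ hn0
  exact SoftLoc.shares hReal hb ENNReal.toReal_nonneg hnk hη hA' hC' hep hFl hρw hgapN hKb (by positivity)

end Summit.AtomisticToContinuum.BoseEinsteinCondensation.Cruxes.PeriodicIRBound.TwoSectorGdTransfer

end
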